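import Literature.NumberTheory.Rogawski1990.AdelicStableConjugacyG
import Literature.NumberTheory.Rogawski1990.RegularEltLocalisation
import Literature.NumberTheory.Rogawski1990.AdelicStableOrbitalIntegral
import HarnessLib

/-!
# The placewise inner-transfer product: `Φ′^st_∞(γ₀ ⊗ 1) · ∏_{v ∈ S} Φ′^st_v((γ₀)_v) = Φ^st_∞(γ ⊗ 1) · ∏_{v ∈ S} Φ^st_v(γ_v)`
(Rogawski (1990), §14.2 (14.2.1) p. 232 read at the rational base point `γ₀ ↔ γ`, place by place; §5.4 (5.4.3) pp. 72–73)

Topic `NumberTheory/Rogawski1990`; namespace `Literature.NumberTheory.Rogawski1990`.  THEOREMS ONLY: no definition, no named fact,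
no instance, no `sorry`.  Cell `pub/hodgecm-mathlib`, ENGINE T1, O11 ∕ T1b assembly, row (G3) of the census
`CENSUS-O11-0-T1bAssembly` (step S7, the `κ = 1` term): the inner form `G′ = U(H)` and the quasi-split `G = U(Φ₃)`
(`Φ₃ = antidiag(1,1,1)`), a rational REGULAR `γ₀ ∈ U(H)(L⁺)` with rational correspondent `γ ∈ U(Φ₃)(L⁺)` (★ `Corresponds (cmConjRingHom L) H Φ₃ γ₀ γ`:
conjugate in `GL₃(L)`).  If the local test functions are inner transfers of each other at every finite place (★ `IsLocalInnerTransfer`, (14.2.1)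
at `v`) and at infinity (★ `IsArchInnerTransfer`), then FACTOR BY FACTOR the local ∕ archimedean stable orbital integrals at the components of
`γ₀` (★ `cmDatum.toLocal v (toAdelic γ₀)`, ★ `cmRationalToArch … γ₀`) equal those at the components of `γ` — because a global correspondence
localises everywhere (★ `corresponds_toLocal_toAdelic`, ★ `corresponds_cmRationalToArch`) and regularity localises (★ `isRegularElt_toLocal_toAdelic`,
★ `isRegularElt_cmRationalToArch`) — hence the archimedean factor times any finite product over `S` agree (§2), in particular for the factors of
two pure tensors `T`, `T′` (§3), and an Euler factorisation `IsEulerOnClasses … S (v ↦ Φ^st_v(γ_v)) (Φ^st_∞(γ ⊗ 1))` on the `G`-side may be READ with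
the `G′`-side factors (§4).  Pure bookkeeping over ★ relations; unconditional.
HC_CM is proved only modulo the printed citations until rung 0 closes.

## References
* [Rogawski1990] J. D. Rogawski, *Automorphic Representations of Unitary Groups in Three Variables*, Ann. of Math. Stud. 123 (1990),
  §14.1–§14.2 (14.2.1) p. 232; §5.4 (5.4.3) pp. 72–73.
-/

noncomputable section

open NumberField IsDedekindDomain
open scoped MatrixGroups

namespace Literature.NumberTheory.Rogawski1990

open Literature.NumberTheory.Automorphic

section InnerTransferProduct

variable {L : Type} [Field L] [NumberField L] [IsCMField L] {H : Matrix (Fin 3) (Fin 3) L}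
  {γ₀ : (UnitaryGroup.cmDatum L 3 H).Rational}
  {γ : (UnitaryGroup.cmDatum L 3 (Matrix.of fun i j : Fin 3 => if i.val + j.val + 1 = 3 then (1 : L) else 0)).Rational}

section Local

variable
  [∀ (v : HeightOneSpectrum (𝓞 ↥(maximalRealSubfield L))) (x : (UnitaryGroup.cmDatum L 3 H).Local v),
    MeasurableSpace ((UnitaryGroup.cmDatum L 3 H).Local v ⧸ Subgroup.centralizer ({x} : Set ((UnitaryGroup.cmDatum L 3 H).Local v)))]
  [∀ (v : HeightOneSpectrum (𝓞 ↥(maximalRealSubfield L)))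
    (x : (UnitaryGroup.cmDatum L 3 (Matrix.of fun i j : Fin 3 => if i.val + j.val + 1 = 3 then (1 : L) else 0)).Local v),
    MeasurableSpace ((UnitaryGroup.cmDatum L 3 (Matrix.of fun i j : Fin 3 => if i.val + j.val + 1 = 3 then (1 : L) else 0)).Local v ⧸
      Subgroup.centralizer ({x} : Set ((UnitaryGroup.cmDatum L 3 (Matrix.of fun i j : Fin 3 => if i.val + j.val + 1 = 3 then (1 : L) else 0)).Local v)))]

/-! ## §1 Factor by factor: (14.2.1) read at the rational base point -/

/-- **(14.2.1) at the finite place `v`, read at the base point**: if `f′_v → f_v` (★ `IsLocalInnerTransfer`) and `γ₀ ↔ γ` globally with `γ₀`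
regular, then `Φ′^st_v((γ₀)_v, f′_v; m′_v) = Φ^st_v(γ_v, f_v; m_v)` — the components correspond (★ `corresponds_toLocal_toAdelic`) and `γ_v` is
regular (★ `isRegularElt_toLocal_toAdelic`, regularity passing along `↔` by ★ `isRegularElt_of_isConj`). [cite: Rogawski1990, §14.2 (14.2.1) p. 232] -/
theorem localStableOrbitalIntegral_base_eq_of_isLocalInnerTransfer (v : HeightOneSpectrum (𝓞 ↥(maximalRealSubfield L)))
    {m' : OrbitalMeasureFamily ((UnitaryGroup.cmDatum L 3 H).Local v)}
    {m : OrbitalMeasureFamily ((UnitaryGroup.cmDatum L 3 (Matrix.of fun i j : Fin 3 => if i.val + j.val + 1 = 3 then (1 : L) else 0)).Local v)}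
    {f' : (UnitaryGroup.cmDatum L 3 H).Local v → ℂ}
    {f : (UnitaryGroup.cmDatum L 3 (Matrix.of fun i j : Fin 3 => if i.val + j.val + 1 = 3 then (1 : L) else 0)).Local v → ℂ}
    (hloc : IsLocalInnerTransfer L H v m' m f' f)
    (hγ : Corresponds (cmConjRingHom L) H (Matrix.of fun i j : Fin 3 => if i.val + j.val + 1 = 3 then (1 : L) else 0) γ₀ γ)
    (hreg : IsRegularElt (γ₀.val : GL (Fin 3) L)) :
    localStableOrbitalIntegral L 3 H v m' f' ((UnitaryGroup.cmDatum L 3 H).toLocal v ((UnitaryGroup.cmDatum L 3 H).toAdelic γ₀)) =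
      localStableOrbitalIntegral L 3 (Matrix.of fun i j : Fin 3 => if i.val + j.val + 1 = 3 then (1 : L) else 0) v m f
        ((UnitaryGroup.cmDatum L 3 (Matrix.of fun i j : Fin 3 => if i.val + j.val + 1 = 3 then (1 : L) else 0)).toLocal v
          ((UnitaryGroup.cmDatum L 3 (Matrix.of fun i j : Fin 3 => if i.val + j.val + 1 = 3 then (1 : L) else 0)).toAdelic γ)) :=
  ((hloc _ (isRegularElt_toLocal_toAdelic L (Matrix.of fun i j : Fin 3 => if i.val + j.val + 1 = 3 then (1 : L) else 0) γ
    (isRegularElt_of_isConj hγ hreg) v)).1 _ (corresponds_toLocal_toAdelic hγ v)).symm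

/-- **The finite product over any finite set of places `S`**: `∏_{v ∈ S} Φ′^st_v((γ₀)_v, f′_v) = ∏_{v ∈ S} Φ^st_v(γ_v, f_v)`
(§1 factor by factor, `Finset.prod_congr`). [cite: Rogawski1990, §14.2 (14.2.1) p. 232] -/
theorem prod_localStableOrbitalIntegral_base_eq_of_isLocalInnerTransfer
    (m' : ∀ v : HeightOneSpectrum (𝓞 ↥(maximalRealSubfield L)), OrbitalMeasureFamily ((UnitaryGroup.cmDatum L 3 H).Local v))
    (m : ∀ v : HeightOneSpectrum (𝓞 ↥(maximalRealSubfield L)),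
      OrbitalMeasureFamily ((UnitaryGroup.cmDatum L 3 (Matrix.of fun i j : Fin 3 => if i.val + j.val + 1 = 3 then (1 : L) else 0)).Local v))
    (f' : ∀ v : HeightOneSpectrum (𝓞 ↥(maximalRealSubfield L)), (UnitaryGroup.cmDatum L 3 H).Local v → ℂ)
    (f : ∀ v : HeightOneSpectrum (𝓞 ↥(maximalRealSubfield L)),
      (UnitaryGroup.cmDatum L 3 (Matrix.of fun i j : Fin 3 => if i.val + j.val + 1 = 3 then (1 : L) else 0)).Local v → ℂ)
    (hloc : ∀ v, IsLocalInnerTransfer L H v (m' v) (m v) (f' v) (f v))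
    (hγ : Corresponds (cmConjRingHom L) H (Matrix.of fun i j : Fin 3 => if i.val + j.val + 1 = 3 then (1 : L) else 0) γ₀ γ)
    (hreg : IsRegularElt (γ₀.val : GL (Fin 3) L)) (S : Finset (HeightOneSpectrum (𝓞 ↥(maximalRealSubfield L)))) :
    ∏ v ∈ S, localStableOrbitalIntegral L 3 H v (m' v) (f' v) ((UnitaryGroup.cmDatum L 3 H).toLocal v ((UnitaryGroup.cmDatum L 3 H).toAdelic γ₀)) =
      ∏ v ∈ S, localStableOrbitalIntegral L 3 (Matrix.of fun i j : Fin 3 => if i.val + j.val + 1 = 3 then (1 : L) else 0) v (m v) (f v)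
        ((UnitaryGroup.cmDatum L 3 (Matrix.of fun i j : Fin 3 => if i.val + j.val + 1 = 3 then (1 : L) else 0)).toLocal v
          ((UnitaryGroup.cmDatum L 3 (Matrix.of fun i j : Fin 3 => if i.val + j.val + 1 = 3 then (1 : L) else 0)).toAdelic γ)) :=
  Finset.prod_congr rfl fun v _ => localStableOrbitalIntegral_base_eq_of_isLocalInnerTransfer v (hloc v) hγ hreg

end Local

section Arch

variable
  [∀ a : UnitaryGroup.arch (↥(maximalRealSubfield L)) L (IsCMField.complexConj L) 3 H,
    MeasurableSpace (UnitaryGroup.arch (↥(maximalRealSubfield L)) L (IsCMField.complexConj L) 3 H ⧸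
      Subgroup.centralizer ({a} : Set (UnitaryGroup.arch (↥(maximalRealSubfield L)) L (IsCMField.complexConj L) 3 H)))]
  [∀ a : UnitaryGroup.arch (↥(maximalRealSubfield L)) L (IsCMField.complexConj L) 3 (Matrix.of fun i j : Fin 3 => if i.val + j.val + 1 = 3 then (1 : L) else 0),
    MeasurableSpace (UnitaryGroup.arch (↥(maximalRealSubfield L)) L (IsCMField.complexConj L) 3 (Matrix.of fun i j : Fin 3 => if i.val + j.val + 1 = 3 then (1 : L) else 0) ⧸
      Subgroup.centralizer ({a} : Set (UnitaryGroup.arch (↥(maximalRealSubfield L)) L (IsCMField.complexConj L) 3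
        (Matrix.of fun i j : Fin 3 => if i.val + j.val + 1 = 3 then (1 : L) else 0))))]

/-- **(14.2.1) at infinity, read at the base point**: if `f′_∞ → f_∞` (★ `IsArchInnerTransfer`) and `γ₀ ↔ γ` globally with `γ₀` regular, then
`Φ′^st_∞(γ₀ ⊗ 1, f′_∞; m′_∞) = Φ^st_∞(γ ⊗ 1, f_∞; m_∞)` (★ `corresponds_cmRationalToArch`, ★ `isRegularElt_cmRationalToArch`).
[cite: Rogawski1990, §14.2 (14.2.1) p. 232] -/
theorem archStableOrbitalIntegral_base_eq_of_isArchInnerTransfer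
    {m' : OrbitalMeasureFamily (UnitaryGroup.arch (↥(maximalRealSubfield L)) L (IsCMField.complexConj L) 3 H)}
    {m : OrbitalMeasureFamily (UnitaryGroup.arch (↥(maximalRealSubfield L)) L (IsCMField.complexConj L) 3
      (Matrix.of fun i j : Fin 3 => if i.val + j.val + 1 = 3 then (1 : L) else 0))}
    {a' : UnitaryGroup.arch (↥(maximalRealSubfield L)) L (IsCMField.complexConj L) 3 H → ℂ}
    {a : UnitaryGroup.arch (↥(maximalRealSubfield L)) L (IsCMField.complexConj L) 3
      (Matrix.of fun i j : Fin 3 => if i.val + j.val + 1 = 3 then (1 : L) else 0) → ℂ}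
    (harch : IsArchInnerTransfer L H m' m a' a)
    (hγ : Corresponds (cmConjRingHom L) H (Matrix.of fun i j : Fin 3 => if i.val + j.val + 1 = 3 then (1 : L) else 0) γ₀ γ)
    (hreg : IsRegularElt (γ₀.val : GL (Fin 3) L)) :
    archStableOrbitalIntegral L 3 H m' a' (cmRationalToArch L 3 H γ₀) =
      archStableOrbitalIntegral L 3 (Matrix.of fun i j : Fin 3 => if i.val + j.val + 1 = 3 then (1 : L) else 0) m a
        (cmRationalToArch L 3 (Matrix.of fun i j : Fin 3 => if i.val + j.val + 1 = 3 then (1 : L) else 0) γ) :=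
  ((harch _ (isRegularElt_cmRationalToArch L (Matrix.of fun i j : Fin 3 => if i.val + j.val + 1 = 3 then (1 : L) else 0) γ
    (isRegularElt_of_isConj hγ hreg))).1 _ (corresponds_cmRationalToArch hγ)).symm

end Arch

section Product

variable
  [∀ (v : HeightOneSpectrum (𝓞 ↥(maximalRealSubfield L))) (x : (UnitaryGroup.cmDatum L 3 H).Local v),
    MeasurableSpace ((UnitaryGroup.cmDatum L 3 H).Local v ⧸ Subgroup.centralizer ({x} : Set ((UnitaryGroup.cmDatum L 3 H).Local v)))]
  [∀ (v : HeightOneSpectrum (𝓞 ↥(maximalRealSubfield L)))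
    (x : (UnitaryGroup.cmDatum L 3 (Matrix.of fun i j : Fin 3 => if i.val + j.val + 1 = 3 then (1 : L) else 0)).Local v),
    MeasurableSpace ((UnitaryGroup.cmDatum L 3 (Matrix.of fun i j : Fin 3 => if i.val + j.val + 1 = 3 then (1 : L) else 0)).Local v ⧸
      Subgroup.centralizer ({x} : Set ((UnitaryGroup.cmDatum L 3 (Matrix.of fun i j : Fin 3 => if i.val + j.val + 1 = 3 then (1 : L) else 0)).Local v)))]

variable
  [∀ a : UnitaryGroup.arch (↥(maximalRealSubfield L)) L (IsCMField.complexConj L) 3 H,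
    MeasurableSpace (UnitaryGroup.arch (↥(maximalRealSubfield L)) L (IsCMField.complexConj L) 3 H ⧸
      Subgroup.centralizer ({a} : Set (UnitaryGroup.arch (↥(maximalRealSubfield L)) L (IsCMField.complexConj L) 3 H)))]
  [∀ a : UnitaryGroup.arch (↥(maximalRealSubfield L)) L (IsCMField.complexConj L) 3 (Matrix.of fun i j : Fin 3 => if i.val + j.val + 1 = 3 then (1 : L) else 0),
    MeasurableSpace (UnitaryGroup.arch (↥(maximalRealSubfield L)) L (IsCMField.complexConj L) 3 (Matrix.of fun i j : Fin 3 => if i.val + j.val + 1 = 3 then (1 : L) else 0) ⧸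
      Subgroup.centralizer ({a} : Set (UnitaryGroup.arch (↥(maximalRealSubfield L)) L (IsCMField.complexConj L) 3
        (Matrix.of fun i j : Fin 3 => if i.val + j.val + 1 = 3 then (1 : L) else 0))))]

/-! ## §2 The placewise inner-transfer product -/

/-- **THE PLACEWISE INNER-TRANSFER PRODUCT** (generic local ∕ archimedean factors): under `f′_v → f_v` at every finite `v`, `f′_∞ → f_∞`,
`γ₀ ↔ γ` with `γ₀` regular, for every finite set of places `S`:
`Φ′^st_∞(γ₀ ⊗ 1, f′_∞) · ∏_{v ∈ S} Φ′^st_v((γ₀)_v, f′_v) = Φ^st_∞(γ ⊗ 1, f_∞) · ∏_{v ∈ S} Φ^st_v(γ_v, f_v)`.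
[cite: Rogawski1990, §14.2 (14.2.1) p. 232] [cite: Rogawski1990, §5.4 (5.4.3) pp. 72–73] -/
theorem archStableOrbitalIntegral_mul_prod_base_eq_of_innerTransfer
    (m' : ∀ v : HeightOneSpectrum (𝓞 ↥(maximalRealSubfield L)), OrbitalMeasureFamily ((UnitaryGroup.cmDatum L 3 H).Local v))
    (m : ∀ v : HeightOneSpectrum (𝓞 ↥(maximalRealSubfield L)),
      OrbitalMeasureFamily ((UnitaryGroup.cmDatum L 3 (Matrix.of fun i j : Fin 3 => if i.val + j.val + 1 = 3 then (1 : L) else 0)).Local v))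
    (mi' : OrbitalMeasureFamily (UnitaryGroup.arch (↥(maximalRealSubfield L)) L (IsCMField.complexConj L) 3 H))
    (mi : OrbitalMeasureFamily (UnitaryGroup.arch (↥(maximalRealSubfield L)) L (IsCMField.complexConj L) 3
      (Matrix.of fun i j : Fin 3 => if i.val + j.val + 1 = 3 then (1 : L) else 0)))
    (f' : ∀ v : HeightOneSpectrum (𝓞 ↥(maximalRealSubfield L)), (UnitaryGroup.cmDatum L 3 H).Local v → ℂ)
    (f : ∀ v : HeightOneSpectrum (𝓞 ↥(maximalRealSubfield L)),
      (UnitaryGroup.cmDatum L 3 (Matrix.of fun i j : Fin 3 => if i.val + j.val + 1 = 3 then (1 : L) else 0)).Local v → ℂ)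
    (a' : UnitaryGroup.arch (↥(maximalRealSubfield L)) L (IsCMField.complexConj L) 3 H → ℂ)
    (a : UnitaryGroup.arch (↥(maximalRealSubfield L)) L (IsCMField.complexConj L) 3
      (Matrix.of fun i j : Fin 3 => if i.val + j.val + 1 = 3 then (1 : L) else 0) → ℂ)
    (hloc : ∀ v, IsLocalInnerTransfer L H v (m' v) (m v) (f' v) (f v)) (harch : IsArchInnerTransfer L H mi' mi a' a)
    (hγ : Corresponds (cmConjRingHom L) H (Matrix.of fun i j : Fin 3 => if i.val + j.val + 1 = 3 then (1 : L) else 0) γ₀ γ)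
    (hreg : IsRegularElt (γ₀.val : GL (Fin 3) L)) (S : Finset (HeightOneSpectrum (𝓞 ↥(maximalRealSubfield L)))) :
    archStableOrbitalIntegral L 3 H mi' a' (cmRationalToArch L 3 H γ₀) *
        ∏ v ∈ S, localStableOrbitalIntegral L 3 H v (m' v) (f' v) ((UnitaryGroup.cmDatum L 3 H).toLocal v ((UnitaryGroup.cmDatum L 3 H).toAdelic γ₀)) =
      archStableOrbitalIntegral L 3 (Matrix.of fun i j : Fin 3 => if i.val + j.val + 1 = 3 then (1 : L) else 0) mi a
          (cmRationalToArch L 3 (Matrix.of fun i j : Fin 3 => if i.val + j.val + 1 = 3 then (1 : L) else 0) γ) *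
        ∏ v ∈ S, localStableOrbitalIntegral L 3 (Matrix.of fun i j : Fin 3 => if i.val + j.val + 1 = 3 then (1 : L) else 0) v (m v) (f v)
          ((UnitaryGroup.cmDatum L 3 (Matrix.of fun i j : Fin 3 => if i.val + j.val + 1 = 3 then (1 : L) else 0)).toLocal v
            ((UnitaryGroup.cmDatum L 3 (Matrix.of fun i j : Fin 3 => if i.val + j.val + 1 = 3 then (1 : L) else 0)).toAdelic γ)) := by
  rw [archStableOrbitalIntegral_base_eq_of_isArchInnerTransfer harch hγ hreg,
    prod_localStableOrbitalIntegral_base_eq_of_isLocalInnerTransfer m' m f' f hloc hγ hreg S]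

/-! ## §3 The product for two pure tensors `T`, `T′` (census (G3) signature) -/

/-- **THE PLACEWISE INNER-TRANSFER PRODUCT FOR PURE TENSORS** `T` on `G′ = U(H)`, `T′` on `G = U(Φ₃)`: if `T_v → T′_v` at every finite `v`
(★ `IsLocalInnerTransfer … (mG v) (mq v) (T.loc v) (T′.loc v)`) and `T_∞ → T′_∞` (★ `IsArchInnerTransfer … mGi mqi T.arch T′.arch`), and `γ₀ ↔ γ` with `γ₀`
regular, then for every finite `S`:
`Φ^st_∞(γ₀ ⊗ 1, T_∞; mGi) · ∏_{v ∈ S} Φ^st_v((γ₀)_v, T_v; mG v) = Φ^st_∞(γ ⊗ 1, T′_∞; mqi) · ∏_{v ∈ S} Φ^st_v(γ_v, T′_v; mq v)`.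
[cite: Rogawski1990, §14.2 (14.2.1) p. 232] [cite: Rogawski1990, §5.4 (5.4.3) pp. 72–73] -/
theorem archStableOrbitalIntegral_mul_prod_base_eq_of_innerTransfer_pureTensor
    (mG : ∀ v : HeightOneSpectrum (𝓞 ↥(maximalRealSubfield L)), OrbitalMeasureFamily ((UnitaryGroup.cmDatum L 3 H).Local v))
    (mq : ∀ v : HeightOneSpectrum (𝓞 ↥(maximalRealSubfield L)),
      OrbitalMeasureFamily ((UnitaryGroup.cmDatum L 3 (Matrix.of fun i j : Fin 3 => if i.val + j.val + 1 = 3 then (1 : L) else 0)).Local v))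
    (mGi : OrbitalMeasureFamily (UnitaryGroup.arch (↥(maximalRealSubfield L)) L (IsCMField.complexConj L) 3 H))
    (mqi : OrbitalMeasureFamily (UnitaryGroup.arch (↥(maximalRealSubfield L)) L (IsCMField.complexConj L) 3
      (Matrix.of fun i j : Fin 3 => if i.val + j.val + 1 = 3 then (1 : L) else 0)))
    (T : UnitaryGroup.PureTensor L 3 H)
    (T' : UnitaryGroup.PureTensor L 3 (Matrix.of fun i j : Fin 3 => if i.val + j.val + 1 = 3 then (1 : L) else 0))
    (hloc : ∀ v, IsLocalInnerTransfer L H v (mG v) (mq v) (T.loc v) (T'.loc v))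
    (harch : IsArchInnerTransfer L H mGi mqi T.arch T'.arch)
    (hγ : Corresponds (cmConjRingHom L) H (Matrix.of fun i j : Fin 3 => if i.val + j.val + 1 = 3 then (1 : L) else 0) γ₀ γ)
    (hreg : IsRegularElt (γ₀.val : GL (Fin 3) L)) (S : Finset (HeightOneSpectrum (𝓞 ↥(maximalRealSubfield L)))) :
    archStableOrbitalIntegral L 3 H mGi T.arch (cmRationalToArch L 3 H γ₀) *
        ∏ v ∈ S, localStableOrbitalIntegral L 3 H v (mG v) (T.loc v) ((UnitaryGroup.cmDatum L 3 H).toLocal v ((UnitaryGroup.cmDatum L 3 H).toAdelic γ₀)) =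
      archStableOrbitalIntegral L 3 (Matrix.of fun i j : Fin 3 => if i.val + j.val + 1 = 3 then (1 : L) else 0) mqi T'.arch
          (cmRationalToArch L 3 (Matrix.of fun i j : Fin 3 => if i.val + j.val + 1 = 3 then (1 : L) else 0) γ) *
        ∏ v ∈ S, localStableOrbitalIntegral L 3 (Matrix.of fun i j : Fin 3 => if i.val + j.val + 1 = 3 then (1 : L) else 0) v (mq v) (T'.loc v)
          ((UnitaryGroup.cmDatum L 3 (Matrix.of fun i j : Fin 3 => if i.val + j.val + 1 = 3 then (1 : L) else 0)).toLocal v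
            ((UnitaryGroup.cmDatum L 3 (Matrix.of fun i j : Fin 3 => if i.val + j.val + 1 = 3 then (1 : L) else 0)).toAdelic γ)) :=
  archStableOrbitalIntegral_mul_prod_base_eq_of_innerTransfer mG mq mGi mqi T.loc T'.loc T.arch T'.arch hloc harch hγ hreg S

/-! ## §4 Reading a `G`-side Euler factorisation with the `G′`-side factors -/

/-- **EULER FACTORISATIONS TRANSPORT ALONG THE INNER TRANSFER**: an Euler factorisation of an adelic stable orbital sum over any carrier
(★ `IsEulerOnClasses 𝒞 μ φ S (v ↦ Φ^st_v(γ_v, f_v; m_v)) (Φ^st_∞(γ ⊗ 1, f_∞; m_∞))`, the shape delivered on the `G = U(Φ₃)` side by ★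
`MatchingAdeleG.exists_isEulerOnClasses_ofLocalAdelic`) is the SAME factorisation with the `G′ = U(H)`-side factors at `γ₀`
(`Φ′^st_v((γ₀)_v, f′_v; m′_v)`, `Φ′^st_∞(γ₀ ⊗ 1, f′_∞; m′_∞)`) whenever `f′ → f` placewise and `γ₀ ↔ γ`, `γ₀` regular.
[cite: Rogawski1990, §5.4 (5.4.3) pp. 72–73] [cite: Rogawski1990, §14.2 (14.2.1) p. 232] -/
theorem isEulerOnClasses_innerForm_of_innerTransfer {Γ : Type*} [Group Γ]
    [∀ g : Γ, MeasurableSpace (Γ ⧸ Subgroup.centralizer ({g} : Set Γ))]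
    (𝒞 : Set (ConjClasses Γ)) (μ : OrbitalMeasureFamily Γ) (φ : Γ → ℂ)
    (m' : ∀ v : HeightOneSpectrum (𝓞 ↥(maximalRealSubfield L)), OrbitalMeasureFamily ((UnitaryGroup.cmDatum L 3 H).Local v))
    (m : ∀ v : HeightOneSpectrum (𝓞 ↥(maximalRealSubfield L)),
      OrbitalMeasureFamily ((UnitaryGroup.cmDatum L 3 (Matrix.of fun i j : Fin 3 => if i.val + j.val + 1 = 3 then (1 : L) else 0)).Local v))
    (mi' : OrbitalMeasureFamily (UnitaryGroup.arch (↥(maximalRealSubfield L)) L (IsCMField.complexConj L) 3 H))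
    (mi : OrbitalMeasureFamily (UnitaryGroup.arch (↥(maximalRealSubfield L)) L (IsCMField.complexConj L) 3
      (Matrix.of fun i j : Fin 3 => if i.val + j.val + 1 = 3 then (1 : L) else 0)))
    (f' : ∀ v : HeightOneSpectrum (𝓞 ↥(maximalRealSubfield L)), (UnitaryGroup.cmDatum L 3 H).Local v → ℂ)
    (f : ∀ v : HeightOneSpectrum (𝓞 ↥(maximalRealSubfield L)),
      (UnitaryGroup.cmDatum L 3 (Matrix.of fun i j : Fin 3 => if i.val + j.val + 1 = 3 then (1 : L) else 0)).Local v → ℂ)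
    (a' : UnitaryGroup.arch (↥(maximalRealSubfield L)) L (IsCMField.complexConj L) 3 H → ℂ)
    (a : UnitaryGroup.arch (↥(maximalRealSubfield L)) L (IsCMField.complexConj L) 3
      (Matrix.of fun i j : Fin 3 => if i.val + j.val + 1 = 3 then (1 : L) else 0) → ℂ)
    (hloc : ∀ v, IsLocalInnerTransfer L H v (m' v) (m v) (f' v) (f v)) (harch : IsArchInnerTransfer L H mi' mi a' a)
    (hγ : Corresponds (cmConjRingHom L) H (Matrix.of fun i j : Fin 3 => if i.val + j.val + 1 = 3 then (1 : L) else 0) γ₀ γ)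
    (hreg : IsRegularElt (γ₀.val : GL (Fin 3) L)) (S : Finset (HeightOneSpectrum (𝓞 ↥(maximalRealSubfield L))))
    (h : IsEulerOnClasses 𝒞 μ φ S
      (fun v => localStableOrbitalIntegral L 3 (Matrix.of fun i j : Fin 3 => if i.val + j.val + 1 = 3 then (1 : L) else 0) v (m v) (f v)
        ((UnitaryGroup.cmDatum L 3 (Matrix.of fun i j : Fin 3 => if i.val + j.val + 1 = 3 then (1 : L) else 0)).toLocal v
          ((UnitaryGroup.cmDatum L 3 (Matrix.of fun i j : Fin 3 => if i.val + j.val + 1 = 3 then (1 : L) else 0)).toAdelic γ)))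
      (archStableOrbitalIntegral L 3 (Matrix.of fun i j : Fin 3 => if i.val + j.val + 1 = 3 then (1 : L) else 0) mi a
        (cmRationalToArch L 3 (Matrix.of fun i j : Fin 3 => if i.val + j.val + 1 = 3 then (1 : L) else 0) γ))) :
    IsEulerOnClasses 𝒞 μ φ S
      (fun v => localStableOrbitalIntegral L 3 H v (m' v) (f' v) ((UnitaryGroup.cmDatum L 3 H).toLocal v ((UnitaryGroup.cmDatum L 3 H).toAdelic γ₀)))
      (archStableOrbitalIntegral L 3 H mi' a' (cmRationalToArch L 3 H γ₀)) := by
  rw [IsEulerOnClasses, archStableOrbitalIntegral_mul_prod_base_eq_of_innerTransfer m' m mi' mi f' f a' a hloc harch hγ hreg S]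
  exact h

end Product

end InnerTransferProduct

end Literature.NumberTheory.Rogawski1990

end
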